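import Literature.AlgebraicGeometry.Motives.HirschowitzIyerCurveData
import Literature.AlgebraicGeometry.Resolution.NormalizationInNormal
import Literature.AlgebraicGeometry.Resolution.NormalizationInExtensionGenericPoint
import Literature.AlgebraicGeometry.Resolution.AlterationsCurves
import Literature.AlgebraicGeometry.Resolution.AlterationsDimension
import HarnessLib

/-!
# The parameter curve of the generic strong line (Hirschowitz–Iyer Lemma 2.2, `s = 0`: "we may suppose `Z` projective smooth connected of dimension `r - s`")

Hirschowitz–Iyer 2010, proof of Lemma 2.2 (`s < r`): "By standard arguments, we may suppose that
`Z` is projective smooth connected of dimension `r - s`." For `s = 0`, `r = 1` and a curve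
`W = closure {w}` on `Y`, the generic strong line lives over a finite extension `F'` of `K(W)`
(`Motives/HirschowitzIyerCurveData`); the standard argument is to take for `Z` the NORMALISATION of
`W` in `F'` (`Resolution/NormalizationInExtension`, finite over `W` by E. Noether's theorem,
`NoetherFiniteIntegralClosure_holds`): a proper integral curve over `K`, regular (normal of
dimension one: its local rings at closed points are discrete valuation rings), with function field
`F'` presented by the flat quasi-compact preimmersion `Spec F' → Z` onto the generic point — the
shape in which `Motives/GenericFibreRatSpread` spreads cycles from the generic fibre.

* `paramCurve w F'` — `Z = W^{F'}` over `K`; integral, `Z → Spec K` proper and locally of finite type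
  (`isProper_paramCurve_hom`), `dim Z = dim W` (`height_genericPoint_paramCurve`);
* `isDiscreteValuationRing_stalk_paramCurve` — `𝒪_{Z,z}` is a DVR for `z ≠ η_Z` when `dim W = 1`;
* `paramGen w F' : Spec F' → Z` over `K` — flat, a preimmersion, quasi-compact, with range `{η_Z}`.

## References

* A. Hirschowitz, J. N. N. Iyer, Contemp. Math. 522 (2010), arXiv:0903.5018, §2 Lemma 2.2 (proof).
  [HirschowitzIyer2010]
* Q. Liu, *Algebraic Geometry and Arithmetic Curves* (2002), Def. 4.1.24, Prop. 4.1.27 (normalisation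
  in a finite extension), Prop. 4.1.12 (normal curves are regular). [Liu2002]
-/

noncomputable section

open CategoryTheory AlgebraicGeometry Order
open Literature.AlgebraicGeometry.Resolution

universe u

namespace Literature.AlgebraicGeometry.Motives

section ParamCurve

variable {K : Type u} [Field K] {Y : SchemeOver K} (w : Y.left)
  (F' : Type u) [Field F'] [Algebra (curveField w) F']

/-- **The parameter curve `Z`**: the normalisation of `W = closure {w}` in the extension `F'` of
`K(W)`, over `K` via `Z → W → Y → Spec K`. [cite: HirschowitzIyer2010, §2 Lemma 2.2 (proof)]
[cite: Liu2002, Def. 4.1.24] -/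
def paramCurve : SchemeOver K :=
  Over.mk (normalizationInι (curveOf w).left F' ≫ (curveOf w).hom)

/-- `Z` is integral. [folklore] -/
instance isIntegral_paramCurve_left : IsIntegral (paramCurve w F').left :=
  inferInstanceAs (IsIntegral (normalizationIn (curveOf w).left F'))

/-- The normalisation morphism `Z → W` over `K`. [folklore] -/
def paramCurveToCurve : paramCurve w F' ⟶ curveOf w :=
  Over.homMk (normalizationInι (curveOf w).left F') rfl

/-- Unfolding. [folklore] -/
@[simp]
theorem paramCurveToCurve_left : (paramCurveToCurve w F').left = normalizationInι (curveOf w).left F' := rfl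

/-- Unfolding of the structure morphism. [folklore] -/
theorem paramCurve_hom : (paramCurve w F').hom = normalizationInι (curveOf w).left F' ≫ (curveOf w).hom := rfl

variable [IsProper Y.hom]

/-- `W → Spec K` is proper (`Y` is). [folklore] -/
instance isProper_curveOf_hom : IsProper (curveOf w).hom :=
  inferInstanceAs (IsProper ((ClosedSubvariety.ofPoint Y.left w).ι ≫ Y.hom))

/-- `W → Spec K` is locally of finite type. [folklore] -/
instance locallyOfFiniteType_curveOf_hom : LocallyOfFiniteType (curveOf w).hom := inferInstance

variable [FiniteDimensional (curveField w) F']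

/-- `Z → W` is finite (E. Noether). [cite: Liu2002, Prop. 4.1.27] -/
instance isFinite_paramCurveToCurve_left : IsFinite (paramCurveToCurve w F').left :=
  isFinite_normalizationInι (curveOf w).left F' (curveOf w).hom

/-- `Z → Spec K` is proper. [folklore] -/
instance isProper_paramCurve_hom : IsProper (paramCurve w F').hom := by
  haveI h1 : IsProper (normalizationInι (curveOf w).left F') := by
    haveI : IsFinite (normalizationInι (curveOf w).left F') :=
      inferInstanceAs (IsFinite (paramCurveToCurve w F').left)
    infer_instance
  haveI h2 : IsProper (curveOf w).hom := inferInstance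
  exact inferInstanceAs (IsProper (normalizationInι (curveOf w).left F' ≫ (curveOf w).hom))

/-- `Z → Spec K` is locally of finite type. [folklore] -/
instance locallyOfFiniteType_paramCurve_hom : LocallyOfFiniteType (paramCurve w F').hom := inferInstance

/-- `Z` is quasi-compact. [folklore] -/
instance compactSpace_paramCurve_left : CompactSpace (paramCurve w F').left := by
  haveI : QuasiCompact (paramCurve w F').hom := inferInstance
  haveI : CompactSpace ↥(Spec (CommRingCat.of K)) := inferInstanceAs (CompactSpace (PrimeSpectrum K))
  exact QuasiCompact.compactSpace_of_compactSpace (paramCurve w F').hom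

/-- **`dim Z = dim W`**: the generic point of `Z` has the height of `w`. [cite: Liu2002, Prop. 4.1.27] -/
theorem height_genericPoint_paramCurve :
    height (genericPoint (paramCurve w F').left) = height w := by
  have halt := isAlteration_normalizationInι (curveOf w).left F' (curveOf w).hom
  have hdim := halt.topologicalKrullDim_eq (curveOf w).hom
  have h1 := Scheme.height_genericPoint (paramCurve w F').left
  have h2 := Scheme.height_genericPoint (curveOf w).left
  have h3 : height (genericPoint (curveOf w).left) = height w := by
    rw [← height_top_ofPoint (X := Y.left) w]
    rfl
  have : (height (genericPoint (paramCurve w F').left) : WithBot ℕ∞) = height (genericPoint (curveOf w).left) := by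
    rw [h1, h2]; exact hdim
  rw [← h3]
  exact_mod_cast this

/-- `dim Z ≤ 1` for a curve `W`. [folklore] -/
theorem topologicalKrullDim_paramCurve_le (hw : height w = 1) :
    topologicalKrullDim (paramCurve w F').left ≤ 1 := by
  rw [← Scheme.height_genericPoint, height_genericPoint_paramCurve, hw]
  exact le_rfl

/-- **`Z` is regular**: for a curve `W` the local rings of `Z` at points other than the generic
point are discrete valuation rings. [cite: Liu2002, Prop. 4.1.12] -/
theorem isDiscreteValuationRing_stalk_paramCurve (hw : height w = 1) {z : (paramCurve w F').left}
    (hz : z ≠ genericPoint (paramCurve w F').left) :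
    IsDiscreteValuationRing ((paramCurve w F').left.presheaf.stalk z) := by
  haveI : IsLocallyNoetherian (curveOf w).left := LocallyOfFiniteType.isLocallyNoetherian (curveOf w).hom
  haveI : LocallyOfFiniteType (normalizationInι (curveOf w).left F') :=
    inferInstanceAs (LocallyOfFiniteType (paramCurveToCurve w F').left)
  haveI : IsLocallyNoetherian (normalizationIn (curveOf w).left F') :=
    LocallyOfFiniteType.isLocallyNoetherian (normalizationInι (curveOf w).left F')
  exact isDiscreteValuationRing_stalk_of_dim_le_one
    (fun x => isIntegrallyClosed_stalk_normalizationIn (curveOf w).left F' x)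
    (topologicalKrullDim_paramCurve_le w F' hw) hz

/-! ### The generic point `Spec F' → Z` -/

variable [Algebra K F'] [IsScalarTower K (curveField w) F']

omit [IsProper Y.hom] [FiniteDimensional (curveField w) F'] in
/-- `Spec F' → Z → Spec K` is `Spec` of the structure map. [folklore] -/
theorem toNormalization_comp_paramCurve_hom :
    (fromSpecExtension (curveOf w).left F').toNormalization ≫ (paramCurve w F').hom =
      Spec.map (CommRingCat.ofHom (algebraMap K F')) := by
  change (fromSpecExtension (curveOf w).left F').toNormalization ≫
    (fromSpecExtension (curveOf w).left F').fromNormalization ≫ (curveOf w).hom = _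
  rw [Scheme.Hom.toNormalization_fromNormalization_assoc]
  change (Spec.map (CommRingCat.ofHom (algebraMap (curveField w) F')) ≫
    (curveOf w).left.fromSpecStalk (genericPoint (curveOf w).left)) ≫ (curveOf w).hom = _
  rw [Category.assoc, CurvePlaces.fromSpecStalk_comp_hom, ← Spec.map_comp, ← CommRingCat.ofHom_comp,
    ← IsScalarTower.algebraMap_eq K (curveField w) F']

/-- **The generic point of `Z`** as a `K`-morphism `Spec F' → Z`. [folklore] -/
def paramGen : specOver K F' ⟶ paramCurve w F' :=
  Over.homMk (fromSpecExtension (curveOf w).left F').toNormalization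
    (toNormalization_comp_paramCurve_hom w F')

omit [IsProper Y.hom] [FiniteDimensional (curveField w) F'] in
/-- Unfolding. [folklore] -/
@[simp]
theorem paramGen_left : (paramGen w F').left = (fromSpecExtension (curveOf w).left F').toNormalization := rfl

omit [IsProper Y.hom] [FiniteDimensional (curveField w) F'] in
/-- `Spec F' → Z` hits exactly the generic point. [folklore] -/
theorem range_paramGen : Set.range (paramGen w F').left = {genericPoint (paramCurve w F').left} :=
  range_toNormalization (curveOf w).left F'

omit [IsProper Y.hom] [FiniteDimensional (curveField w) F'] in
/-- `Spec F' → Z` is flat. [folklore] -/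
instance flat_paramGen : Flat (paramGen w F').left := flat_toNormalization (curveOf w).left F'

omit [IsProper Y.hom] in
/-- `Spec F' → Z` is a preimmersion (`K(Z) = F'`). [cite: Liu2002, Def. 4.1.24] -/
instance isPreimmersion_paramGen : IsPreimmersion (paramGen w F').left :=
  isPreimmersion_toNormalization (curveOf w).left F'

omit [IsProper Y.hom] [FiniteDimensional (curveField w) F'] in
/-- `Spec F' → Z` is quasi-compact. [folklore] -/
instance quasiCompact_paramGen : QuasiCompact (paramGen w F').left := by
  refine ⟨fun U _ _ => ?_⟩
  haveI : Finite ↥((specOver K F').left) := inferInstanceAs (Finite (PrimeSpectrum F'))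
  exact (Set.toFinite _).isCompact

end ParamCurve

end Literature.AlgebraicGeometry.Motives

end
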